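import Summits.RiemannHypothesis.RiemannHypothesis.Theorems.Splittings.JensenX4TwoZeroModel
import HarnessLib

/-!
# The two-zero model IS the Jensen data of a Gaussian-type positive kernel (jen-neg g5, §6: the z-side dictionary, kernel)

Cell rh-split, seat rh-split-jen-neg g5 (brief sha16 f79c5f09d8bcb036), card `run/shared/lean/pub/rh-split/cards/SPLIT-jen-neg.md`
SUPPLEMENT S1; §6 of `HOME/rh-split-jen-neg/g5/SketchG5Model.lean` sha16 1f91847e4bb642aa (18 new blocks; referee rh-split-ref g3 replay
PASS + labels 2026-08-27T05:42:39Z: 8-decl axiomProbe std, moment formula re-derived, headline read literally), lead rh-split-lead g3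
RULING #22/#22a (vii)(α); filed by rh-split-typer-2 g4 as the second zero-def file of the carve (§§1–5 = `JensenX4TwoZeroModel.lean`),
decl blocks byte-verbatim, same namespace `…Splittings.JensenX4TwoZeroModel` (the `section Kernel` of the scratch).

HONEST LABEL: «SPLITTING SEARCH over kernel-typed RH-EQUIVALENCES; a splitting A ∧ B ⟹ RH is CONDITIONAL bookkeeping unless A and B are
both proved; nothing here bears on the truth of RH.»

The seat's summary (§6, z-side DICTIONARY, kernel): `kernelMoment_twoZero` / `kernelTaylorSeq_twoZero` — the Gaussian-type kernel
`K_{u,ν}(t) = e^{−t²}(t⁴ − (2u+3)t² + (u+½)² + ν + ½)` has Taylor sequence `(√π/2)·4^{−m}·γ_{u,ν}(m)`, so its Jensen grid IS the model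
grid (`splits_jensenPoly_twoZeroKernel_iff`); `twoZeroKernel_pos` (`u ≤ −3/2`), `_nonneg` (`2u + 3/2 ≤ ν`), `_even`,
`deriv_twoZeroKernel_neg` (`K′ < 0` on `(0,∞)`, `u ≤ −3/2`), `deriv2_log_twoZeroKernel_sqrt_neg` (`log K(√s)` strictly concave for
`u ≤ −3/2`, `ν < (u+5/2)² − 5/2`); HEADLINE `exists_posKernel_rowsFromOne_not_rowZero`: the member `(−5,1)`,
`K = e^{−t²}(t⁴ + 7t² + 87/4)`, is a positive even decreasing kernel with strictly log-concave `K(√s)` whose Jensen data satisfy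
conjunct A, violate conjunct B (at degree 27) and the 𝓛𝓟-analogue (row 0 hyperbolic iff `d ≤ 26`) — «A has slack INSIDE the positive
log-concave kernel class» (g4's named null), kernel-checked: a kernel-CLASS-level NO-GO, RH-FREE (referee S1).  The three private
Gaussian-moment lemmas are copies of the tree's private `LogConcaveKernel.integral_exp_neg_sq_mul_pow`, `integrableOn_exp_neg_sq_mul_pow`,
`factorial_div_mul_Gamma_half` (same proofs).  Nothing here is a claim about the truth of RH.
-/

set_option linter.dupNamespace false

noncomputable section

open Polynomial
open Literature.NumberTheory.LFunctions

namespace Summit.RiemannHypothesis.RiemannHypothesis.Theorems.Splittings.JensenX4TwoZeroModel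

/-! ## §6 The model IS the Jensen data of a Gaussian-type positive kernel (the z-side dictionary, kernel)

`K_{u,ν}(t) := e^{−t²}·(t⁴ − (2u+3)t² + ((u+½)² + ν + ½))` (the harmless factor `2/√π` dropped) has moments
`b_m = ∫₀^∞ K t^{2m} dt = Γ(m+½)/2 · γ_{u,ν}(m)` and Taylor sequence `γ_m(K) = m! b_m/(2m)! = (√π/2)·4^{−m}·γ_{u,ν}(m)`
(its cosine transform is `(√π/2)·E_{u,ν}(−z²/4)`).  So, in the tree's normalisation `kernelTaylorSeq` (the one in
which `xiTaylorCoeff = 64·4^m·γ_m(Φ)`, `xiTaylorCoeff_eq_kernelTaylorSeq`), the Jensen grid of `K_{u,ν}` IS the model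
grid, cell by cell (`splits_jensenPoly_twoZeroKernel_iff`).  `K_{u,ν} > 0` for `u ≤ −3/2` (`≥ 0` as soon as
`2u + 3/2 ≤ ν`), even, `K′ < 0` on `(0,∞)` for `u ≤ −3/2`, and `log K(√s)` is strictly concave when moreover
`ν < (u + 5/2)² − 5/2`; the decay is Gaussian (it misses Dimitrov–Lucas' clause (v) by the same `ε` as the tree's `K_0`,
cf. `LogConcaveKernel.K_le_gaussian`).  HEADLINE `exists_posKernel_rowsFromOne_not_rowZero`: the member
`(u,ν) = (−5,1)`, `K(t) = e^{−t²}(t⁴ + 7t² + 87/4)`, is a positive, even, decreasing kernel with strictly log-concave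
`K(√s)` whose Jensen data satisfy X-4's conjunct A and VIOLATE conjunct B and the 𝓛𝓟-analogue: conjunct A has slack
inside the positive log-concave kernel class (g4's named null), kernel-checked.  The three private Gaussian-moment
lemmas are copies of the tree's private `LogConcaveKernel.integral_exp_neg_sq_mul_pow`,
`integrableOn_exp_neg_sq_mul_pow`, `factorial_div_mul_Gamma_half` (same proofs). -/

section Kernel

open Set MeasureTheory Filter
open scoped Nat Topology
open Literature.Barriers.RiemannHypothesis

/-- Gaussian moments: `∫₀^∞ e^{-t²} t^{2m} dt = Γ(m + ½)/2` (copy of the tree's private lemma). [folklore] -/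
private theorem integral_exp_neg_sq_mul_pow (m : ℕ) :
    ∫ t in Ioi (0 : ℝ), Real.exp (-t ^ 2) * t ^ (2 * m) = Real.Gamma (m + 1 / 2) / 2 := by
  have h := integral_rpow_mul_exp_neg_rpow (p := 2) (q := ((2 * m : ℕ) : ℝ)) two_pos
    (by have : (0 : ℝ) ≤ ((2 * m : ℕ) : ℝ) := Nat.cast_nonneg _; linarith)
  have e : (fun x : ℝ => x ^ ((2 * m : ℕ) : ℝ) * Real.exp (-x ^ (2 : ℝ))) =
      fun x : ℝ => Real.exp (-x ^ 2) * x ^ (2 * m) := by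
    funext x
    rw [Real.rpow_natCast, Real.rpow_two, mul_comm]
  rw [e] at h
  rw [h]
  have e2 : (((2 * m : ℕ) : ℝ) + 1) / 2 = (m : ℝ) + 1 / 2 := by push_cast; ring
  rw [e2]
  ring

/-- Integrability of the Gaussian moments on `(0, ∞)` (copy of the tree's private lemma). [folklore] -/
private theorem integrableOn_exp_neg_sq_mul_pow (m : ℕ) :
    IntegrableOn (fun t : ℝ => Real.exp (-t ^ 2) * t ^ (2 * m)) (Ioi 0) := by
  have h := integrableOn_rpow_mul_exp_neg_rpow (s := ((2 * m : ℕ) : ℝ)) (p := 2)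
    (by have : (0 : ℝ) ≤ ((2 * m : ℕ) : ℝ) := Nat.cast_nonneg _; linarith) (by norm_num)
  have e : (fun x : ℝ => x ^ ((2 * m : ℕ) : ℝ) * Real.exp (-x ^ (2 : ℝ))) =
      fun x : ℝ => Real.exp (-x ^ 2) * x ^ (2 * m) := by
    funext x
    rw [Real.rpow_natCast, Real.rpow_two, mul_comm]
  rwa [e] at h

/-- `(m!/(2m)!)·Γ(m + ½)/2 = (√π/2)·4^{-m}` (copy of the tree's private lemma). [folklore] -/
private theorem factorial_div_mul_Gamma_half (m : ℕ) :
    (m ! : ℝ) / ((2 * m)! : ℝ) * (Real.Gamma (m + 1 / 2) / 2) = Real.sqrt Real.pi / 2 * (1 / 4) ^ m := by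
  induction m with
  | zero => rw [Nat.cast_zero, zero_add, Real.Gamma_one_half_eq]; simp
  | succ m ih =>
    have hpos : (0 : ℝ) < m + 1 / 2 := by positivity
    have hG : Real.Gamma (((m + 1 : ℕ) : ℝ) + 1 / 2) = ((m : ℝ) + 1 / 2) * Real.Gamma (m + 1 / 2) := by
      rw [Nat.cast_succ, show (m : ℝ) + 1 + 1 / 2 = ((m : ℝ) + 1 / 2) + 1 by ring,
        Real.Gamma_add_one hpos.ne']
    have hf1 : ((m + 1)! : ℝ) = ((m : ℝ) + 1) * (m ! : ℝ) := by
      rw [Nat.factorial_succ]; push_cast; ring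
    have hf2 : ((2 * (m + 1))! : ℝ) = (2 * (m : ℝ) + 2) * (2 * (m : ℝ) + 1) * ((2 * m)! : ℝ) := by
      rw [show 2 * (m + 1) = (2 * m + 1) + 1 by ring, Nat.factorial_succ, Nat.factorial_succ]
      push_cast; ring
    have hm0 : ((2 * m)! : ℝ) ≠ 0 := by positivity
    have h21 : (2 * (m : ℝ) + 1) ≠ 0 := by positivity
    have h22 : (2 * (m : ℝ) + 2) ≠ 0 := by positivity
    calc ((m + 1)! : ℝ) / ((2 * (m + 1))! : ℝ) * (Real.Gamma (((m + 1 : ℕ) : ℝ) + 1 / 2) / 2)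
        = (((m : ℝ) + 1) * ((m : ℝ) + 1 / 2) / ((2 * (m : ℝ) + 2) * (2 * (m : ℝ) + 1))) *
            ((m ! : ℝ) / ((2 * m)! : ℝ) * (Real.Gamma (m + 1 / 2) / 2)) := by
          rw [hG, hf1, hf2]
          field_simp
      _ = Real.sqrt Real.pi / 2 * (1 / 4) ^ (m + 1) := by
          rw [ih, pow_succ]
          field_simp
          ring

/-- **Exact moments of the two-zero kernel**: `∫₀^∞ K_{u,ν}(t) t^{2m} dt = Γ(m+½)/2 · ((m−u)² − m + ν)`
(`Γ(m+3/2) = (m+½)Γ(m+½)`, `Γ(m+5/2) = (m+3/2)(m+½)Γ(m+½)`). [folklore] -/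
theorem kernelMoment_twoZero (u ν : ℝ) (m : ℕ) :
    kernelMoment (fun t : ℝ => Real.exp (-t ^ 2) * (t ^ 4 - (2 * u + 3) * t ^ 2 + ((u + 1 / 2) ^ 2 + ν + 1 / 2))) m =
      Real.Gamma (m + 1 / 2) / 2 * (((m : ℝ) - u) ^ 2 - m + ν) := by
  rw [kernelMoment]
  have e : (fun t : ℝ => Real.exp (-t ^ 2) * (t ^ 4 - (2 * u + 3) * t ^ 2 + ((u + 1 / 2) ^ 2 + ν + 1 / 2)) *
      t ^ (2 * m)) = fun t : ℝ => Real.exp (-t ^ 2) * t ^ (2 * (m + 2)) +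
        ((-(2 * u + 3)) * (Real.exp (-t ^ 2) * t ^ (2 * (m + 1))) +
          ((u + 1 / 2) ^ 2 + ν + 1 / 2) * (Real.exp (-t ^ 2) * t ^ (2 * m))) := by
    funext t; ring
  have hA : IntegrableOn (fun t : ℝ => (-(2 * u + 3)) * (Real.exp (-t ^ 2) * t ^ (2 * (m + 1)))) (Ioi 0) :=
    (integrableOn_exp_neg_sq_mul_pow (m + 1)).const_mul _
  have hB : IntegrableOn (fun t : ℝ => ((u + 1 / 2) ^ 2 + ν + 1 / 2) * (Real.exp (-t ^ 2) * t ^ (2 * m))) (Ioi 0) :=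
    (integrableOn_exp_neg_sq_mul_pow m).const_mul _
  have hAB : IntegrableOn (fun t : ℝ => (-(2 * u + 3)) * (Real.exp (-t ^ 2) * t ^ (2 * (m + 1))) +
      ((u + 1 / 2) ^ 2 + ν + 1 / 2) * (Real.exp (-t ^ 2) * t ^ (2 * m))) (Ioi 0) := hA.add hB
  rw [e, integral_add (integrableOn_exp_neg_sq_mul_pow (m + 2)) hAB, integral_add hA hB,
    integral_const_mul, integral_const_mul, integral_exp_neg_sq_mul_pow, integral_exp_neg_sq_mul_pow,
    integral_exp_neg_sq_mul_pow]
  have hpos : (0 : ℝ) < m + 1 / 2 := by positivity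
  have h1 : Real.Gamma (((m + 1 : ℕ) : ℝ) + 1 / 2) = ((m : ℝ) + 1 / 2) * Real.Gamma (m + 1 / 2) := by
    rw [Nat.cast_succ, show (m : ℝ) + 1 + 1 / 2 = ((m : ℝ) + 1 / 2) + 1 by ring,
      Real.Gamma_add_one hpos.ne']
  have h2 : Real.Gamma (((m + 2 : ℕ) : ℝ) + 1 / 2) =
      ((m : ℝ) + 3 / 2) * (((m : ℝ) + 1 / 2) * Real.Gamma (m + 1 / 2)) := by
    rw [Nat.cast_add, Nat.cast_two, show (m : ℝ) + 2 + 1 / 2 = ((m : ℝ) + 1 / 2 + 1) + 1 by ring,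
      Real.Gamma_add_one (by positivity), Real.Gamma_add_one hpos.ne']
    ring
  rw [h1, h2]
  ring

/-- **The Taylor sequence of the two-zero kernel is the model sequence** up to the hyperbolicity-preserving factor
`(√π/2)·4^{−m}`: `γ_m(K_{u,ν}) = (√π/2)·4^{−m}·((m−u)² − m + ν)`. [folklore] -/
theorem kernelTaylorSeq_twoZero (u ν : ℝ) (m : ℕ) :
    kernelTaylorSeq (fun t : ℝ => Real.exp (-t ^ 2) * (t ^ 4 - (2 * u + 3) * t ^ 2 + ((u + 1 / 2) ^ 2 + ν + 1 / 2))) m =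
      Real.sqrt Real.pi / 2 * (1 / 4) ^ m * (((m : ℝ) - u) ^ 2 - m + ν) := by
  rw [kernelTaylorSeq, kernelMoment_twoZero, ← mul_assoc, factorial_div_mul_Gamma_half]

/-- **Dictionary, cell by cell**: a Jensen polynomial of the kernel `K_{u,ν}` is hyperbolic iff the same cell of the
model grid is (`splits_jensenPoly_const_mul_pow_mul_iff`). [folklore] -/
theorem splits_jensenPoly_twoZeroKernel_iff (u ν : ℝ) (d n : ℕ) :
    (jensenPoly (kernelTaylorSeq (fun t : ℝ => Real.exp (-t ^ 2) *
        (t ^ 4 - (2 * u + 3) * t ^ 2 + ((u + 1 / 2) ^ 2 + ν + 1 / 2)))) d n).Splits ↔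
      (jensenPoly (fun m : ℕ => ((m : ℝ) - u) ^ 2 - m + ν) d n).Splits := by
  have e : kernelTaylorSeq (fun t : ℝ => Real.exp (-t ^ 2) *
      (t ^ 4 - (2 * u + 3) * t ^ 2 + ((u + 1 / 2) ^ 2 + ν + 1 / 2))) =
      fun m : ℕ => Real.sqrt Real.pi / 2 * (1 / 4) ^ m * (((m : ℝ) - u) ^ 2 - m + ν) :=
    funext (kernelTaylorSeq_twoZero u ν)
  have hπ : Real.sqrt Real.pi / 2 ≠ 0 := by
    have : 0 < Real.sqrt Real.pi := Real.sqrt_pos.2 Real.pi_pos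
    positivity
  rw [e]
  exact splits_jensenPoly_const_mul_pow_mul_iff hπ (by norm_num) _ d n

/-- `K_{u,ν} > 0` everywhere when `u ≤ −3/2` (all three coefficients of the quartic nonnegative, constant positive).
[folklore] -/
theorem twoZeroKernel_pos {u : ℝ} (ν : ℝ) (hu : u ≤ -3 / 2) (hν : 0 < ν) (t : ℝ) :
    0 < Real.exp (-t ^ 2) * (t ^ 4 - (2 * u + 3) * t ^ 2 + ((u + 1 / 2) ^ 2 + ν + 1 / 2)) := by
  refine mul_pos (Real.exp_pos _) ?_
  have h2 : 0 ≤ t ^ 2 := sq_nonneg t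
  have h4 : 0 ≤ t ^ 4 := by positivity
  nlinarith [sq_nonneg (u + 1 / 2), mul_nonneg (show 0 ≤ -(2 * u + 3) by linarith) h2]

/-- `K_{u,ν} ≥ 0` everywhere as soon as `2u + 3/2 ≤ ν` (complete the square: `t⁴ − (2u+3)t² + c₀ =
(t² − u − 3/2)² + (ν − 2u − 3/2)`). [folklore] -/
theorem twoZeroKernel_nonneg {u ν : ℝ} (h : 2 * u + 3 / 2 ≤ ν) (t : ℝ) :
    0 ≤ Real.exp (-t ^ 2) * (t ^ 4 - (2 * u + 3) * t ^ 2 + ((u + 1 / 2) ^ 2 + ν + 1 / 2)) := by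
  refine mul_nonneg (Real.exp_pos _).le ?_
  nlinarith [sq_nonneg (t ^ 2 - (u + 3 / 2))]

/-- `K_{u,ν}` is even. [folklore] -/
theorem twoZeroKernel_even (u ν t : ℝ) :
    Real.exp (-(-t) ^ 2) * ((-t) ^ 4 - (2 * u + 3) * (-t) ^ 2 + ((u + 1 / 2) ^ 2 + ν + 1 / 2)) =
      Real.exp (-t ^ 2) * (t ^ 4 - (2 * u + 3) * t ^ 2 + ((u + 1 / 2) ^ 2 + ν + 1 / 2)) := by
  rw [show (-t) ^ 2 = t ^ 2 by ring, show (-t) ^ 4 = t ^ 4 by ring]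

/-- The member `(−5, 1)` written out: `K_{−5,1}(t) = e^{−t²}(t⁴ + 7t² + 87/4)`. [folklore] -/
theorem twoZeroKernel_neg_five_one (t : ℝ) :
    Real.exp (-t ^ 2) * (t ^ 4 - (2 * (-5 : ℝ) + 3) * t ^ 2 + (((-5 : ℝ) + 1 / 2) ^ 2 + 1 + 1 / 2)) =
      Real.exp (-t ^ 2) * (t ^ 4 + 7 * t ^ 2 + 87 / 4) := by
  ring

/-- The derivative of `K_{u,ν}`: `K′(t) = 2t e^{−t²}·(−t⁴ + (2u+5)t² − c₀ − (2u+3))`. [folklore] -/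
theorem hasDerivAt_twoZeroKernel (u ν t : ℝ) :
    HasDerivAt (fun t : ℝ => Real.exp (-t ^ 2) * (t ^ 4 - (2 * u + 3) * t ^ 2 + ((u + 1 / 2) ^ 2 + ν + 1 / 2)))
      (Real.exp (-t ^ 2) * (2 * t) *
        (-t ^ 4 + (2 * u + 5) * t ^ 2 - ((u + 1 / 2) ^ 2 + ν + 1 / 2) - (2 * u + 3))) t := by
  have h2 : HasDerivAt (fun t : ℝ => Real.exp (-t ^ 2)) (Real.exp (-t ^ 2) * (-(2 * t))) t := by
    have h := ((hasDerivAt_pow 2 t).fun_neg).exp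
    refine h.congr_deriv ?_
    norm_num
  have h3 : HasDerivAt (fun t : ℝ => t ^ 4 - (2 * u + 3) * t ^ 2 + ((u + 1 / 2) ^ 2 + ν + 1 / 2))
      (4 * t ^ 3 - (2 * u + 3) * (2 * t)) t := by
    have h := ((hasDerivAt_pow 4 t).fun_sub ((hasDerivAt_pow 2 t).const_mul (2 * u + 3))).add_const
      ((u + 1 / 2) ^ 2 + ν + 1 / 2)
    refine h.congr_deriv ?_
    norm_num
  have h := h2.fun_mul h3
  refine h.congr_deriv ?_
  ring

/-- `K_{u,ν}′ < 0` on `(0, ∞)` for `u ≤ −3/2` (`−t⁴ + (2u+5)t² ≤ −t⁴ + 2t² ≤ 1 < (u+3/2)² + 3/2 + ν`). [folklore] -/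
theorem deriv_twoZeroKernel_neg {u : ℝ} (ν : ℝ) (hu : u ≤ -3 / 2) (hν : 0 < ν) {t : ℝ} (ht : 0 < t) :
    deriv (fun t : ℝ => Real.exp (-t ^ 2) * (t ^ 4 - (2 * u + 3) * t ^ 2 + ((u + 1 / 2) ^ 2 + ν + 1 / 2))) t < 0 := by
  rw [(hasDerivAt_twoZeroKernel u ν t).deriv]
  have hbr : -t ^ 4 + (2 * u + 5) * t ^ 2 - ((u + 1 / 2) ^ 2 + ν + 1 / 2) - (2 * u + 3) < 0 := by
    nlinarith [sq_nonneg (t ^ 2 - 1), sq_nonneg (u + 3 / 2),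
      mul_nonneg (show 0 ≤ -(2 * u + 3) by linarith) (sq_nonneg t)]
  have hpos : 0 < Real.exp (-t ^ 2) * (2 * t) := by positivity
  exact mul_neg_of_pos_of_neg hpos hbr

/-- The quadratic factor `Q(s) = s² − (2u+3)s + c₀` of `K_{u,ν}(√s) = e^{−s}Q(s)` is positive on all of `ℝ` when
`u ≤ −3/2` (`Q(s) = (s − u − 3/2)² + (ν − 2u − 3/2)`). [folklore] -/
private theorem quadFactor_pos {u : ℝ} (ν : ℝ) (hu : u ≤ -3 / 2) (hν : 0 < ν) (s : ℝ) :
    0 < s ^ 2 - (2 * u + 3) * s + ((u + 1 / 2) ^ 2 + ν + 1 / 2) := by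
  nlinarith [sq_nonneg (s - (u + 3 / 2))]

/-- `log K_{u,ν}(√s) = −s + log Q(s)` for `s ≥ 0`. [folklore] -/
theorem log_twoZeroKernel_sqrt {u : ℝ} (ν : ℝ) (hu : u ≤ -3 / 2) (hν : 0 < ν) {s : ℝ} (hs : 0 ≤ s) :
    Real.log (Real.exp (-Real.sqrt s ^ 2) *
        (Real.sqrt s ^ 4 - (2 * u + 3) * Real.sqrt s ^ 2 + ((u + 1 / 2) ^ 2 + ν + 1 / 2))) =
      -s + Real.log (s ^ 2 - (2 * u + 3) * s + ((u + 1 / 2) ^ 2 + ν + 1 / 2)) := by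
  have h2 : Real.sqrt s ^ 2 = s := Real.sq_sqrt hs
  have h4 : Real.sqrt s ^ 4 = s ^ 2 := by
    rw [show (4 : ℕ) = 2 * 2 from rfl, pow_mul, h2]
  rw [h2, h4, Real.log_mul (Real.exp_pos _).ne' (quadFactor_pos ν hu hν s).ne', Real.log_exp]

/-- First derivative of the smooth model `−s + log Q(s)`. [folklore] -/
private theorem hasDerivAt_logSqrtModel (u ν : ℝ) {s : ℝ}
    (hQ : s ^ 2 - (2 * u + 3) * s + ((u + 1 / 2) ^ 2 + ν + 1 / 2) ≠ 0) :
    HasDerivAt (fun s : ℝ => -s + Real.log (s ^ 2 - (2 * u + 3) * s + ((u + 1 / 2) ^ 2 + ν + 1 / 2)))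
      (-1 + (2 * s - (2 * u + 3)) / (s ^ 2 - (2 * u + 3) * s + ((u + 1 / 2) ^ 2 + ν + 1 / 2))) s := by
  have hQ' : HasDerivAt (fun s : ℝ => s ^ 2 - (2 * u + 3) * s + ((u + 1 / 2) ^ 2 + ν + 1 / 2))
      (2 * s - (2 * u + 3)) s := by
    have h := ((hasDerivAt_pow 2 s).fun_sub ((hasDerivAt_id' s).const_mul (2 * u + 3))).add_const
      ((u + 1 / 2) ^ 2 + ν + 1 / 2)
    refine h.congr_deriv ?_
    norm_num
  exact (hasDerivAt_id' s).fun_neg.fun_add (hQ'.log hQ)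

/-- Second derivative of the smooth model: `(Q″Q − Q′²)/Q²` with `Q″ = 2`. [folklore] -/
private theorem hasDerivAt_logSqrtModel_deriv (u ν : ℝ) {s : ℝ}
    (hQ : s ^ 2 - (2 * u + 3) * s + ((u + 1 / 2) ^ 2 + ν + 1 / 2) ≠ 0) :
    HasDerivAt (fun s : ℝ => -1 + (2 * s - (2 * u + 3)) / (s ^ 2 - (2 * u + 3) * s + ((u + 1 / 2) ^ 2 + ν + 1 / 2)))
      ((2 * (s ^ 2 - (2 * u + 3) * s + ((u + 1 / 2) ^ 2 + ν + 1 / 2)) -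
          (2 * s - (2 * u + 3)) * (2 * s - (2 * u + 3))) /
        (s ^ 2 - (2 * u + 3) * s + ((u + 1 / 2) ^ 2 + ν + 1 / 2)) ^ 2) s := by
  have hnum : HasDerivAt (fun s : ℝ => 2 * s - (2 * u + 3)) 2 s := by
    simpa using ((hasDerivAt_id' s).const_mul (2 : ℝ)).sub_const (2 * u + 3)
  have hden : HasDerivAt (fun s : ℝ => s ^ 2 - (2 * u + 3) * s + ((u + 1 / 2) ^ 2 + ν + 1 / 2))
      (2 * s - (2 * u + 3)) s := by
    have h := ((hasDerivAt_pow 2 s).fun_sub ((hasDerivAt_id' s).const_mul (2 * u + 3))).add_const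
      ((u + 1 / 2) ^ 2 + ν + 1 / 2)
    refine h.congr_deriv ?_
    norm_num
  exact (hnum.fun_div hden hQ).const_add (-1)


/-- **Strict log-concavity of `K_{u,ν}(√s)`** (Dimitrov–Lucas' (8) / Varga (3.28) for the model kernel): for
`u ≤ −3/2`, `0 < ν < (u + 5/2)² − 5/2` and every `s > 0`, `(d²/ds²) log K_{u,ν}(√s) < 0`; indeed the numerator
`2Q − Q′² = −2s² + (4u+6)s + (2ν + 5 − 2(u+5/2)²)` is negative. [folklore] -/
theorem deriv2_log_twoZeroKernel_sqrt_neg {u : ℝ} (ν : ℝ) (hu : u ≤ -3 / 2) (hν : 0 < ν)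
    (hlc : ν < (u + 5 / 2) ^ 2 - 5 / 2) {s : ℝ} (hs : 0 < s) :
    deriv^[2] (fun s : ℝ => Real.log (Real.exp (-Real.sqrt s ^ 2) *
        (Real.sqrt s ^ 4 - (2 * u + 3) * Real.sqrt s ^ 2 + ((u + 1 / 2) ^ 2 + ν + 1 / 2)))) s < 0 := by
  have hloc : (fun s : ℝ => Real.log (Real.exp (-Real.sqrt s ^ 2) *
        (Real.sqrt s ^ 4 - (2 * u + 3) * Real.sqrt s ^ 2 + ((u + 1 / 2) ^ 2 + ν + 1 / 2)))) =ᶠ[𝓝 s]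
      fun s : ℝ => -s + Real.log (s ^ 2 - (2 * u + 3) * s + ((u + 1 / 2) ^ 2 + ν + 1 / 2)) := by
    filter_upwards [Ioi_mem_nhds hs] with x hx using log_twoZeroKernel_sqrt ν hu hν hx.le
  have hd1 : deriv (fun s : ℝ => Real.log (Real.exp (-Real.sqrt s ^ 2) *
        (Real.sqrt s ^ 4 - (2 * u + 3) * Real.sqrt s ^ 2 + ((u + 1 / 2) ^ 2 + ν + 1 / 2)))) =ᶠ[𝓝 s]
      fun s : ℝ => -1 + (2 * s - (2 * u + 3)) / (s ^ 2 - (2 * u + 3) * s + ((u + 1 / 2) ^ 2 + ν + 1 / 2)) := by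
    refine hloc.eventually_nhds.mono fun x hx => ?_
    have hx' : (fun s : ℝ => Real.log (Real.exp (-Real.sqrt s ^ 2) *
        (Real.sqrt s ^ 4 - (2 * u + 3) * Real.sqrt s ^ 2 + ((u + 1 / 2) ^ 2 + ν + 1 / 2)))) =ᶠ[𝓝 x]
        fun s : ℝ => -s + Real.log (s ^ 2 - (2 * u + 3) * s + ((u + 1 / 2) ^ 2 + ν + 1 / 2)) := hx
    rw [hx'.deriv_eq]
    exact (hasDerivAt_logSqrtModel u ν (quadFactor_pos ν hu hν x).ne').deriv
  show deriv (deriv fun s : ℝ => Real.log (Real.exp (-Real.sqrt s ^ 2) *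
        (Real.sqrt s ^ 4 - (2 * u + 3) * Real.sqrt s ^ 2 + ((u + 1 / 2) ^ 2 + ν + 1 / 2)))) s < 0
  rw [hd1.deriv_eq, (hasDerivAt_logSqrtModel_deriv u ν (quadFactor_pos ν hu hν s).ne').deriv]
  have hQ := quadFactor_pos ν hu hν s
  have hnum : 2 * (s ^ 2 - (2 * u + 3) * s + ((u + 1 / 2) ^ 2 + ν + 1 / 2)) -
      (2 * s - (2 * u + 3)) * (2 * s - (2 * u + 3)) < 0 := by
    nlinarith [mul_nonneg (show 0 ≤ -(4 * u + 6) by linarith) hs.le, sq_nonneg s]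
  exact div_neg_of_neg_of_pos hnum (by positivity)

/-- **HEADLINE (g4's named null, kernel-checked).**  There is a positive, even kernel, strictly decreasing on
`(0,∞)`, with `log K(√s)` strictly concave on `(0,∞)` — namely `K(t) = e^{−t²}(t⁴ + 7t² + 87/4)`, the member
`(u,ν) = (−5,1)` — whose Jensen data `γ_m(K) = m! b_m/(2m)!` satisfy X-4's conjunct A (every `J^{d,n}`, `n ≥ 1`,
hyperbolic), violate the 𝓛𝓟-analogue (some `J^{d,0}` is not hyperbolic — exactly those with `d ≥ 27`), and violate
X-4's conjunct B (the strict Laguerre sign law fails at degree `27`).  So «admissible-type positive log-concave kernel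
+ conjunct A» does not give row `0`: A has slack, B is critical, inside the kernel class. [folklore] -/
theorem exists_posKernel_rowsFromOne_not_rowZero :
    ∃ K : ℝ → ℝ, (∀ t, 0 < K t) ∧ (∀ t, K (-t) = K t) ∧ (∀ t, 0 < t → deriv K t < 0) ∧
      (∀ s, 0 < s → deriv^[2] (fun s => Real.log (K (Real.sqrt s))) s < 0) ∧
      (∀ d n : ℕ, 1 ≤ n → (jensenPoly (kernelTaylorSeq K) d n).Splits) ∧
      ¬ (∀ d n : ℕ, (jensenPoly (kernelTaylorSeq K) d n).Splits) ∧
      (∀ d : ℕ, (jensenPoly (kernelTaylorSeq K) d 0).Splits ↔ d ≤ 26) ∧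
      ¬ (∀ d : ℕ, 2 ≤ d → ∀ x : ℝ,
          (derivative (jensenPoly (kernelTaylorSeq K) d 0)).eval x = 0 →
          (jensenPoly (kernelTaylorSeq K) d 0).eval x ≠ 0 →
          (jensenPoly (kernelTaylorSeq K) d 0).eval x *
            (derivative (derivative (jensenPoly (kernelTaylorSeq K) d 0))).eval x < 0) := by
  have hu : (-5 : ℝ) ≤ -3 / 2 := by norm_num
  have hu0 : (-5 : ℝ) ≤ 0 := by norm_num
  refine ⟨fun t : ℝ => Real.exp (-t ^ 2) * (t ^ 4 - (2 * (-5 : ℝ) + 3) * t ^ 2 + (((-5 : ℝ) + 1 / 2) ^ 2 + 1 + 1 / 2)),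
    twoZeroKernel_pos 1 hu one_pos, fun t => twoZeroKernel_even _ _ t,
    fun t ht => deriv_twoZeroKernel_neg 1 hu one_pos ht,
    fun s hs => deriv2_log_twoZeroKernel_sqrt_neg 1 hu one_pos (by norm_num) hs, ?_, ?_, ?_, ?_⟩
  · -- conjunct A
    intro d n hn
    rw [splits_jensenPoly_twoZeroKernel_iff]
    exact (model_rowsFromOne_iff hu0 one_pos).2 le_rfl d n hn
  · -- not all hyperbolic
    intro h
    refine model_not_allHyperbolic hu0 one_pos (fun d n => ?_)
    rw [← splits_jensenPoly_twoZeroKernel_iff]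
    exact h d n
  · -- row 0 decided: hyperbolic iff d ≤ 26
    intro d
    rw [splits_jensenPoly_twoZeroKernel_iff]
    obtain ⟨hlow, hfail⟩ := model_rowZero_threshold hu0 one_pos
    have hfloor : ⌊(-5 : ℝ) ^ 2 / 1⌋₊ = 25 := by norm_num
    rw [hfloor] at hlow hfail
    constructor
    · intro h
      by_contra hlt
      rw [not_le] at hlt
      obtain ⟨e, rfl⟩ := Nat.exists_eq_add_of_le' (show 2 ≤ d by omega)
      rw [model_splits_iff hu0 one_pos] at h
      have he : (25 : ℝ) ≤ e := by exact_mod_cast (show 25 ≤ e by omega)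
      push_cast at h
      nlinarith
    · intro h
      exact hlow d (by omega)
  · -- conjunct B fails at degree 27 (mask lemma: row 1 hyperbolic at degree 26, row 0 not at 27)
    intro hB
    have hrow1 : (jensenPoly (kernelTaylorSeq (fun t : ℝ => Real.exp (-t ^ 2) *
        (t ^ 4 - (2 * (-5 : ℝ) + 3) * t ^ 2 + (((-5 : ℝ) + 1 / 2) ^ 2 + 1 + 1 / 2)))) (24 + 2) 1).Splits := by
      rw [splits_jensenPoly_twoZeroKernel_iff, model_splits_iff hu0 one_pos]
      norm_num
    have hfail : ¬ (jensenPoly (kernelTaylorSeq (fun t : ℝ => Real.exp (-t ^ 2) *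
        (t ^ 4 - (2 * (-5 : ℝ) + 3) * t ^ 2 + (((-5 : ℝ) + 1 / 2) ^ 2 + 1 + 1 / 2)))) (25 + 2) 0).Splits := by
      rw [splits_jensenPoly_twoZeroKernel_iff, model_splits_iff hu0 one_pos]
      norm_num
    have hne : kernelTaylorSeq (fun t : ℝ => Real.exp (-t ^ 2) *
        (t ^ 4 - (2 * (-5 : ℝ) + 3) * t ^ 2 + (((-5 : ℝ) + 1 / 2) ^ 2 + 1 + 1 / 2))) (24 + 2 + 1) ≠ 0 := by
      rw [kernelTaylorSeq_twoZero]
      have hπ : 0 < Real.sqrt Real.pi := Real.sqrt_pos.2 Real.pi_pos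
      norm_num [hπ.ne']
    have hmask := Summit.RiemannHypothesis.RiemannHypothesis.Theorems.Splittings.JensenShiftMonoCorner.laguerreAt_iff_splits_of_rowOne
      hne hrow1
    exact hfail (hmask.1 (hB (24 + 2 + 1) (by norm_num)))

end Kernel

end Summit.RiemannHypothesis.RiemannHypothesis.Theorems.Splittings.JensenX4TwoZeroModel

end
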